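import Summits.HodgeConjecture.HodgeConjecture.Theses.AdelicCoherence
import Literature.AlgebraicGeometry.Motives.MotivatedCyclesLefschetzProofs

/-!
# Birth skeleton of piece P1 `CoherentClassesMotivated` (CM) — line "absoluteness first" (Ogus Hope 4.11.3, then André)

Two stubs and the kernel-checked composition `CoherentClassesMotivated_of`:
* `stub_coherentPlane_absolutelyHodge` — OGUS HOPE 4.11.3 IN PLANE FORM: a k-rational de Rham plane `W` whose
  ρ-complexification lies in the Hodge plane of `X_ρ` and whose elements are potentially Tate at every good place (for
  every crystalline Frobenius datum) is Hodge at EVERY embedding `σ : k →+* ℂ` ('absolutely Tate ⇒ absolutely Hodge';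
  theorem for CM abelian varieties, Fermat hypersurfaces, projective spaces: Ogus 1982 Thm 4.16, LNM 900 p. 312);
* `stub_absolutelyHodgePlane_motivated` — 'ABSOLUTELY HODGE-AND-TATE ⇒ MOTIVATED' IN PLANE FORM (Ogus's `H_AHT`, the weakest composable form):
  Hodge classes of `X_ρ` lying in the ℂ-span of a k-rational de Rham plane that is Hodge at EVERY embedding and potentially Tate at every good place
  are André-motivated (André 1996 p. 9: "chaque fois
  qu'on sait prouver qu'une classe est de Hodge absolue, le même argument montre qu'elle est motivée"; theorem for abelian
  varieties — every Hodge class is motivated, André 1996 Thm 0.6.2 — and varieties of abelian motive, Thm 0.6.3);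
composition: modus ponens along W (stub 1 upgrades 'Hodge at ρ + Tate' to 'Hodge at every σ'; stub 2 consumes absoluteness AND the Tate
hypothesis — strictly weaker than both the piece and 'absolute Hodge ⇒ motivated'), then `rfl` between
`WeilCohomology.motivatedClasses` and the inlined André span of the piece.
-/

set_option linter.dupNamespace false
set_option linter.unusedVariables false

namespace Summit.HodgeConjecture.HodgeConjecture.Cruxes.CoherentClassesAlgebraic.PiecesSplit.P1

open Literature.AlgebraicGeometry.Motives CategoryTheory MonoidalCategory CartesianMonoidalCategory

/-! ### §1 Stub statements as obligation nodes (by name); the piece as a named Prop (until the split lands it in the route) -/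

/-- The piece CM `CoherentClassesMotivated`, verbatim (the composition concludes this name; after `route edit --split`
re-register against the route decl). -/
abbrev CoherentClassesMotivated : Prop :=
  ∀ ⦃k : Type⦄ [Field k] [NumberField k] (ρ : k →+* ℂ) (P : PeriodRealization k), HodgeRiemannIStatement P.B → HodgeRiemannIIStatement P.B → P.B.W.HasHardLefschetz → ∀ ⦃n : ℕ⦄ ⦃X : SchemeOver k⦄, IsSmoothProjective n X → ∀ (hXρ : IsSmoothProjective n ((baseChangeHom ρ).obj X)) (p : ℕ) (W : Submodule k (P.dR.obj X (2 * p))), (∀ w ∈ W, alongHomTensorEquiv ρ ((P.B.comap ρ).obj X (2 * p)) (P.iso ρ X (2 * p) ((1 : AlongHom ℂ ρ) ⊗ₜ[k] w)) ∈ ((P.B.hodge hXρ (2 * p)).hodgeClasses p).baseChange ℂ) → (∀ (v : IsDedekindDomain.HeightOneSpectrum (NumberField.RingOfIntegers k)), HasGoodReductionAt X n v → ∀ (Φ : CrystallineFrobeniusDatum P.dR v (v.adicCompletion k)), ∀ w ∈ W, ∃ m : ℕ, 0 < m ∧ ((Φ.phi X (2 * p)) ^ m) ((1 : v.adicCompletion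 k) ⊗ₜ[k] w) = ((v.residueCard : v.adicCompletion k) ^ (p * m)) • ((1 : v.adicCompletion k) ⊗ₜ[k] w)) → ∀ β ∈ (P.B.hodge hXρ (2 * p)).hodgeClasses p, (1 : ℂ) ⊗ₜ[ℚ] β ∈ Submodule.span ℂ ((fun w => alongHomTensorEquiv ρ ((P.B.comap ρ).obj X (2 * p)) (P.iso ρ X (2 * p) ((1 : AlongHom ℂ ρ) ⊗ₜ[k] w))) '' (W : Set (P.dR.obj X (2 * p)))) → β ∈ Submodule.span ℚ {x : P.B.W.obj ((baseChangeHom ρ).obj X) (2 * p) | ∃ (m : ℕ) (Y : SchemeOver ℂ) (_ : IsSmoothProjective m Y) (η : P.B.W.obj (((baseChangeHom ρ).obj X) ⊗ Y) 2) (_ : P.B.W.IsHyperplaneClass (((baseChangeHom ρ).obj X) ⊗ Y) η) (S : P.B.W.GradedOp (((baseChangeHom ρ).obj X) ⊗ Y) (((baseChangeHom ρ).obj X) ⊗ Y)) (_ : P.B.W.IsLefschetzStar (n + m) η S) (a b b' : ℕ) (_ : b + b' = n + m) (hab : a + b' = p + m) (α : P.B.W.obj (((baseChangeHom ρ).obj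 X) ⊗ Y) (2 * a)) (γ : P.B.W.obj (((baseChangeHom ρ).obj X) ⊗ Y) (2 * b)), α ∈ P.B.W.ratAlgebraicClasses (((baseChangeHom ρ).obj X) ⊗ Y) a ∧ γ ∈ P.B.W.ratAlgebraicClasses (((baseChangeHom ρ).obj X) ⊗ Y) b ∧ ∀ (q : ℕ) (hq : p + q = n) (y : P.B.W.obj ((baseChangeHom ρ).obj X) (2 * q)), P.B.W.cupPairing ((baseChangeHom ρ).obj X) n (2 * p) (2 * q) (by omega) x y = P.B.W.trace (((baseChangeHom ρ).obj X) ⊗ Y) (n + m) (P.B.W.cup (show 2 * (p + m) + 2 * q = 2 * (n + m) by omega) (P.B.W.cup (show 2 * a + 2 * b' = 2 * (p + m) by omega) α (S (2 * b) (2 * b') γ)) (P.B.W.pullback (fst ((baseChangeHom ρ).obj X) Y) (2 * q) y))}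

/-- Statement of `stub_coherentPlane_absolutelyHodge`, verbatim. -/
abbrev Statement.stub_coherentPlane_absolutelyHodge : Prop :=
  ∀ ⦃k : Type⦄ [Field k] [NumberField k] (ρ : k →+* ℂ) (P : PeriodRealization k), HodgeRiemannIStatement P.B → HodgeRiemannIIStatement P.B → P.B.W.HasHardLefschetz → ∀ ⦃n : ℕ⦄ ⦃X : SchemeOver k⦄, IsSmoothProjective n X → ∀ (hXρ : IsSmoothProjective n ((baseChangeHom ρ).obj X)) (p : ℕ) (W : Submodule k (P.dR.obj X (2 * p))), (∀ w ∈ W, alongHomTensorEquiv ρ ((P.B.comap ρ).obj X (2 * p)) (P.iso ρ X (2 * p) ((1 : AlongHom ℂ ρ) ⊗ₜ[k] w)) ∈ ((P.B.hodge hXρ (2 * p)).hodgeClasses p).baseChange ℂ) → (∀ (v : IsDedekindDomain.HeightOneSpectrum (NumberField.RingOfIntegers k)), HasGoodReductionAt X n v → ∀ (Φ : CrystallineFrobeniusDatum P.dR v (v.adicCompletion k)), ∀ w ∈ W, ∃ m : ℕ, 0 < m ∧ ((Φ.phi X (2 * p)) ^ m) ((1 : v.adicCompletion k) ⊗ₜ[k]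 w) = ((v.residueCard : v.adicCompletion k) ^ (p * m)) • ((1 : v.adicCompletion k) ⊗ₜ[k] w)) → (∀ (σ : k →+* ℂ) (hXσ : IsSmoothProjective n ((baseChangeHom σ).obj X)), ∀ w ∈ W, alongHomTensorEquiv σ ((P.B.comap σ).obj X (2 * p)) (P.iso σ X (2 * p) ((1 : AlongHom ℂ σ) ⊗ₜ[k] w)) ∈ ((P.B.hodge hXσ (2 * p)).hodgeClasses p).baseChange ℂ)

/-- Statement of `stub_absolutelyHodgePlane_motivated`, verbatim. -/
abbrev Statement.stub_absolutelyHodgePlane_motivated : Prop :=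
  ∀ ⦃k : Type⦄ [Field k] [NumberField k] (ρ : k →+* ℂ) (P : PeriodRealization k), HodgeRiemannIStatement P.B → HodgeRiemannIIStatement P.B → P.B.W.HasHardLefschetz → ∀ ⦃n : ℕ⦄ ⦃X : SchemeOver k⦄, IsSmoothProjective n X → ∀ (hXρ : IsSmoothProjective n ((baseChangeHom ρ).obj X)) (p : ℕ) (W : Submodule k (P.dR.obj X (2 * p))), (∀ (σ : k →+* ℂ) (hXσ : IsSmoothProjective n ((baseChangeHom σ).obj X)), ∀ w ∈ W, alongHomTensorEquiv σ ((P.B.comap σ).obj X (2 * p)) (P.iso σ X (2 * p) ((1 : AlongHom ℂ σ) ⊗ₜ[k] w)) ∈ ((P.B.hodge hXσ (2 * p)).hodgeClasses p).baseChange ℂ) → (∀ (v : IsDedekindDomain.HeightOneSpectrum (NumberField.RingOfIntegers k)), HasGoodReductionAt X n v → ∀ (Φ : CrystallineFrobeniusDatum P.dR v (v.adicCompletion k)), ∀ w ∈ W, ∃ m : ℕ, 0 < m ∧ ((Φ.phi X (2 * p)) ^ m) ((1 : v.adicCompletion k) ⊗ₜ[k] w) = ((v.residueCard : v.adicCompletion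 k) ^ (p * m)) • ((1 : v.adicCompletion k) ⊗ₜ[k] w)) → ∀ β ∈ (P.B.hodge hXρ (2 * p)).hodgeClasses p, (1 : ℂ) ⊗ₜ[ℚ] β ∈ Submodule.span ℂ ((fun w => alongHomTensorEquiv ρ ((P.B.comap ρ).obj X (2 * p)) (P.iso ρ X (2 * p) ((1 : AlongHom ℂ ρ) ⊗ₜ[k] w))) '' (W : Set (P.dR.obj X (2 * p)))) → β ∈ P.B.W.motivatedClasses n ((baseChangeHom ρ).obj X) p

/-! ### §2 Stubs (signatures written out) and §3 composition -/

/-- Stub 1 (Ogus Hope 4.11.3, plane form): a de Rham-rational, potentially-Tate Hodge plane is Hodge at every embedding.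
[Ogus1982 Hopes 4.11, Prop 4.15, Thm 4.16; Deligne1982HodgeCycles Thm 2.11; Blasius1994] -/
theorem stub_coherentPlane_absolutelyHodge :
    ∀ ⦃k : Type⦄ [Field k] [NumberField k] (ρ : k →+* ℂ) (P : PeriodRealization k), HodgeRiemannIStatement P.B → HodgeRiemannIIStatement P.B → P.B.W.HasHardLefschetz → ∀ ⦃n : ℕ⦄ ⦃X : SchemeOver k⦄, IsSmoothProjective n X → ∀ (hXρ : IsSmoothProjective n ((baseChangeHom ρ).obj X)) (p : ℕ) (W : Submodule k (P.dR.obj X (2 * p))), (∀ w ∈ W, alongHomTensorEquiv ρ ((P.B.comap ρ).obj X (2 * p)) (P.iso ρ X (2 * p) ((1 : AlongHom ℂ ρ) ⊗ₜ[k] w)) ∈ ((P.B.hodge hXρ (2 * p)).hodgeClasses p).baseChange ℂ) → (∀ (v : IsDedekindDomain.HeightOneSpectrum (NumberField.RingOfIntegers k)), HasGoodReductionAt X n v → ∀ (Φ : CrystallineFrobeniusDatum P.dR v (v.adicCompletion k)), ∀ w ∈ W, ∃ m : ℕ, 0 < m ∧ ((Φ.phi X (2 * p)) ^ m) ((1 :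 v.adicCompletion k) ⊗ₜ[k] w) = ((v.residueCard : v.adicCompletion k) ^ (p * m)) • ((1 : v.adicCompletion k) ⊗ₜ[k] w)) → (∀ (σ : k →+* ℂ) (hXσ : IsSmoothProjective n ((baseChangeHom σ).obj X)), ∀ w ∈ W, alongHomTensorEquiv σ ((P.B.comap σ).obj X (2 * p)) (P.iso σ X (2 * p) ((1 : AlongHom ℂ σ) ⊗ₜ[k] w)) ∈ ((P.B.hodge hXσ (2 * p)).hodgeClasses p).baseChange ℂ) := by
  sorry

/-- Stub 2 ('absolutely Hodge-and-Tate ⇒ motivated', plane form — Ogus's `H_AHT`): Hodge classes in a k-rational de Rham plane that is Hodge at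
every embedding and potentially Tate at every good place are motivated. [Andre1996Motifs Thm 0.6.2, 0.6.3, Prop 2.5.1, p. 9; Deligne1982HodgeCycles §2; CharlesSchnell2014Notes §11.2.5] -/
theorem stub_absolutelyHodgePlane_motivated :
    ∀ ⦃k : Type⦄ [Field k] [NumberField k] (ρ : k →+* ℂ) (P : PeriodRealization k), HodgeRiemannIStatement P.B → HodgeRiemannIIStatement P.B → P.B.W.HasHardLefschetz → ∀ ⦃n : ℕ⦄ ⦃X : SchemeOver k⦄, IsSmoothProjective n X → ∀ (hXρ : IsSmoothProjective n ((baseChangeHom ρ).obj X)) (p : ℕ) (W : Submodule k (P.dR.obj X (2 * p))), (∀ (σ : k →+* ℂ) (hXσ : IsSmoothProjective n ((baseChangeHom σ).obj X)), ∀ w ∈ W, alongHomTensorEquiv σ ((P.B.comap σ).obj X (2 * p)) (P.iso σ X (2 * p) ((1 : AlongHom ℂ σ) ⊗ₜ[k] w)) ∈ ((P.B.hodge hXσ (2 * p)).hodgeClasses p).baseChange ℂ) → (∀ (v : IsDedekindDomain.HeightOneSpectrum (NumberField.RingOfIntegers k)), HasGoodReductionAt X n v → ∀ (Φ : CrystallineFrobeniusDatum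 P.dR v (v.adicCompletion k)), ∀ w ∈ W, ∃ m : ℕ, 0 < m ∧ ((Φ.phi X (2 * p)) ^ m) ((1 : v.adicCompletion k) ⊗ₜ[k] w) = ((v.residueCard : v.adicCompletion k) ^ (p * m)) • ((1 : v.adicCompletion k) ⊗ₜ[k] w)) → ∀ β ∈ (P.B.hodge hXρ (2 * p)).hodgeClasses p, (1 : ℂ) ⊗ₜ[ℚ] β ∈ Submodule.span ℂ ((fun w => alongHomTensorEquiv ρ ((P.B.comap ρ).obj X (2 * p)) (P.iso ρ X (2 * p) ((1 : AlongHom ℂ ρ) ⊗ₜ[k] w))) '' (W : Set (P.dR.obj X (2 * p)))) → β ∈ P.B.W.motivatedClasses n ((baseChangeHom ρ).obj X) p := by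
  sorry

/-- Composition: the two stubs give the piece CM (by name; hypotheses = the obligation nodes by name). -/
theorem CoherentClassesMotivated_of
    (h₁ : Statement.stub_coherentPlane_absolutelyHodge)
    (h₂ : Statement.stub_absolutelyHodgePlane_motivated) :
    CoherentClassesMotivated := by
  intro k _ _ ρ P hI hII hL n X hX hXρ p W hW hT β hβ hspan
  have hmot := h₂ ρ P hI hII hL hX hXρ p W (h₁ ρ P hI hII hL hX hXρ p W hW hT) hT β hβ hspan
  exact hmot

/-- The literal written-out form (same term): stub statements → the piece statement verbatim. -/
example :
    (∀ ⦃k : Type⦄ [Field k] [NumberField k] (ρ : k →+* ℂ) (P : PeriodRealization k), HodgeRiemannIStatement P.B → HodgeRiemannIIStatement P.B → P.B.W.HasHardLefschetz → ∀ ⦃n : ℕ⦄ ⦃X : SchemeOver k⦄, IsSmoothProjective n X → ∀ (hXρ : IsSmoothProjective n ((baseChangeHom ρ).obj X)) (p : ℕ) (W : Submodule k (P.dR.obj X (2 * p))), (∀ w ∈ W, alongHomTensorEquiv ρ ((P.B.comap ρ).obj X (2 * p)) (P.iso ρ X (2 * p) ((1 : AlongHom ℂ ρ) ⊗ₜ[k]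 w)) ∈ ((P.B.hodge hXρ (2 * p)).hodgeClasses p).baseChange ℂ) → (∀ (v : IsDedekindDomain.HeightOneSpectrum (NumberField.RingOfIntegers k)), HasGoodReductionAt X n v → ∀ (Φ : CrystallineFrobeniusDatum P.dR v (v.adicCompletion k)), ∀ w ∈ W, ∃ m : ℕ, 0 < m ∧ ((Φ.phi X (2 * p)) ^ m) ((1 : v.adicCompletion k) ⊗ₜ[k] w) = ((v.residueCard : v.adicCompletion k) ^ (p * m)) • ((1 : v.adicCompletion k) ⊗ₜ[k] w)) → (∀ (σ : k →+* ℂ) (hXσ : IsSmoothProjective n ((baseChangeHom σ).obj X)), ∀ w ∈ W, alongHomTensorEquiv σ ((P.B.comap σ).obj X (2 * p)) (P.iso σ X (2 * p) ((1 : AlongHom ℂ σ) ⊗ₜ[k] w)) ∈ ((P.B.hodge hXσ (2 * p)).hodgeClasses p).baseChange ℂ)) →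
    (∀ ⦃k : Type⦄ [Field k] [NumberField k] (ρ : k →+* ℂ) (P : PeriodRealization k), HodgeRiemannIStatement P.B → HodgeRiemannIIStatement P.B → P.B.W.HasHardLefschetz → ∀ ⦃n : ℕ⦄ ⦃X : SchemeOver k⦄, IsSmoothProjective n X → ∀ (hXρ : IsSmoothProjective n ((baseChangeHom ρ).obj X)) (p : ℕ) (W : Submodule k (P.dR.obj X (2 * p))), (∀ (σ : k →+* ℂ) (hXσ : IsSmoothProjective n ((baseChangeHom σ).obj X)), ∀ w ∈ W, alongHomTensorEquiv σ ((P.B.comap σ).obj X (2 * p)) (P.iso σ X (2 * p) ((1 : AlongHom ℂ σ) ⊗ₜ[k] w)) ∈ ((P.B.hodge hXσ (2 * p)).hodgeClasses p).baseChange ℂ) → (∀ (v : IsDedekindDomain.HeightOneSpectrum (NumberField.RingOfIntegers k)), HasGoodReductionAt X n v → ∀ (Φ : CrystallineFrobeniusDatum P.dR v (v.adicCompletion k)), ∀ w ∈ W, ∃ m : ℕ, 0 < m ∧ ((Φ.phi X (2 * p)) ^ m) ((1 : v.adicCompletion k) ⊗ₜ[k] w) = ((v.residueCard : v.adicCompletion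 k) ^ (p * m)) • ((1 : v.adicCompletion k) ⊗ₜ[k] w)) → ∀ β ∈ (P.B.hodge hXρ (2 * p)).hodgeClasses p, (1 : ℂ) ⊗ₜ[ℚ] β ∈ Submodule.span ℂ ((fun w => alongHomTensorEquiv ρ ((P.B.comap ρ).obj X (2 * p)) (P.iso ρ X (2 * p) ((1 : AlongHom ℂ ρ) ⊗ₜ[k] w))) '' (W : Set (P.dR.obj X (2 * p)))) → β ∈ P.B.W.motivatedClasses n ((baseChangeHom ρ).obj X) p) →
    (∀ ⦃k : Type⦄ [Field k] [NumberField k] (ρ : k →+* ℂ) (P : PeriodRealization k), HodgeRiemannIStatement P.B → HodgeRiemannIIStatement P.B → P.B.W.HasHardLefschetz → ∀ ⦃n : ℕ⦄ ⦃X : SchemeOver k⦄, IsSmoothProjective n X → ∀ (hXρ : IsSmoothProjective n ((baseChangeHom ρ).obj X)) (p : ℕ) (W : Submodule k (P.dR.obj X (2 * p))), (∀ w ∈ W, alongHomTensorEquiv ρ ((P.B.comap ρ).obj X (2 * p)) (P.iso ρ X (2 * p) ((1 : AlongHom ℂ ρ) ⊗ₜ[k] w)) ∈ ((P.B.hodge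 hXρ (2 * p)).hodgeClasses p).baseChange ℂ) → (∀ (v : IsDedekindDomain.HeightOneSpectrum (NumberField.RingOfIntegers k)), HasGoodReductionAt X n v → ∀ (Φ : CrystallineFrobeniusDatum P.dR v (v.adicCompletion k)), ∀ w ∈ W, ∃ m : ℕ, 0 < m ∧ ((Φ.phi X (2 * p)) ^ m) ((1 : v.adicCompletion k) ⊗ₜ[k] w) = ((v.residueCard : v.adicCompletion k) ^ (p * m)) • ((1 : v.adicCompletion k) ⊗ₜ[k] w)) → ∀ β ∈ (P.B.hodge hXρ (2 * p)).hodgeClasses p, (1 : ℂ) ⊗ₜ[ℚ] β ∈ Submodule.span ℂ ((fun w => alongHomTensorEquiv ρ ((P.B.comap ρ).obj X (2 * p)) (P.iso ρ X (2 * p) ((1 : AlongHom ℂ ρ) ⊗ₜ[k] w))) '' (W : Set (P.dR.obj X (2 * p)))) → β ∈ Submodule.span ℚ {x : P.B.W.obj ((baseChangeHom ρ).obj X) (2 * p) | ∃ (m : ℕ) (Y : SchemeOver ℂ) (_ : IsSmoothProjective m Y) (η : P.B.W.obj (((baseChangeHom ρ).obj X) ⊗ Y) 2) (_ : P.B.W.IsHyperplaneClass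 (((baseChangeHom ρ).obj X) ⊗ Y) η) (S : P.B.W.GradedOp (((baseChangeHom ρ).obj X) ⊗ Y) (((baseChangeHom ρ).obj X) ⊗ Y)) (_ : P.B.W.IsLefschetzStar (n + m) η S) (a b b' : ℕ) (_ : b + b' = n + m) (hab : a + b' = p + m) (α : P.B.W.obj (((baseChangeHom ρ).obj X) ⊗ Y) (2 * a)) (γ : P.B.W.obj (((baseChangeHom ρ).obj X) ⊗ Y) (2 * b)), α ∈ P.B.W.ratAlgebraicClasses (((baseChangeHom ρ).obj X) ⊗ Y) a ∧ γ ∈ P.B.W.ratAlgebraicClasses (((baseChangeHom ρ).obj X) ⊗ Y) b ∧ ∀ (q : ℕ) (hq : p + q = n) (y : P.B.W.obj ((baseChangeHom ρ).obj X) (2 * q)), P.B.W.cupPairing ((baseChangeHom ρ).obj X) n (2 * p) (2 * q) (by omega) x y = P.B.W.trace (((baseChangeHom ρ).obj X) ⊗ Y) (n + m) (P.B.W.cup (show 2 * (p + m) + 2 * q = 2 * (n + m) by omega) (P.B.W.cup (show 2 * a + 2 * b' = 2 * (p + m) by omega) α (S (2 * b) (2 * b') γ)) (P.B.W.pullback (fst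 ((baseChangeHom ρ).obj X) Y) (2 * q) y))}) :=
  CoherentClassesMotivated_of

/-- The piece from the two stubs. -/
theorem coherentClassesMotivated : CoherentClassesMotivated :=
  CoherentClassesMotivated_of stub_coherentPlane_absolutelyHodge stub_absolutelyHodgePlane_motivated

end Summit.HodgeConjecture.HodgeConjecture.Cruxes.CoherentClassesAlgebraic.PiecesSplit.P1
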